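import Summits.HubbardSuperconductivity.HubbardSuperconductivity.Theses.DeformationLadder
import Literature.MathematicalPhysics.QuantumLattice.PairFieldMomentum

/-!
# Crux-triage r2-1, idea `marginal-rigidity` (crux stmt-HubbardSuperconductivity-1890 `LadderThesis`)

Kernel check of the triage claim: **at every point `(U, δ)` the card's conjecture `MarginalRigidity`
is sandwiched between the crux and the bare implication "summit ∧ window-condensation ⇒ crux"**:

  `LER_at U δ  ⟹  MR_at U δ  ⟹  ( (∃ a>0, SummitAt U δ a) → CondensationAt U δ → LER_at U δ )`

and both hypotheses of the right-hand implication are themselves consequences of `LER_at`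
(`summitAt_of_lerAt`, `condensationAt_of_lerAt`).  Here `LER_at` is the body of the route decl
`LowEnergyRigidity` (≡ `LadderThesis`, p89166) at the point `(U, δ)` written with the card's
`pairWeight L 0` (= `L⁻⁴ Re⟨Δ_dᴴΔ_d⟩`, `pairMode L 0 = pairField`: all phases `1`), and `MR_at`,
`SummitAt`, `CondensationAt`, `pairMode`, `pairWeight`, `inWindow` are copied VERBATIM from the
ideator's `Cruxes/LadderThesis/SketchIdeator4.lean` (`MarginalRigidity := ∀ U>0, ∀ δ ∈ Ioo 0 ½, MR_at U δ`).
So `MR` restricted to the witness is exactly "the missing implication (S ∧ stmt-1510 ⇒ stmt-1890)",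
i.e. the transfer stub `stmt-1510 → stmt-1890` of the dead line `Sketch` weakened by the extra
hypothesis `S`, and nothing finite-dimensional separates it from the crux.
-/

noncomputable section

namespace CruxTriage.MarginalRigidity

open Literature.MathematicalPhysics.QuantumLattice Literature.Probability.LatticeModels Matrix
open scoped ComplexOrder BigOperators

section Objects
variable (L : ℕ) [NeZero L]

/-- (verbatim, SketchIdeator4) `Δ_d(k) = Σ_x e^{-2πi k·x/L} • localPair d L x`. -/
def pairMode (k : TorusSite 2 L) :
    Matrix (Finset (Orb (FermionTorus 2 L))) (Finset (Orb (FermionTorus 2 L))) ℂ :=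
  ∑ x : TorusSite 2 L,
    Complex.exp (-(2 * (Real.pi : ℂ) * Complex.I / (L : ℂ)) *
        ((∑ i : Fin 2, (k i).val * (x i).val : ℕ) : ℂ)) • localPair dWaveFormFactor L x

/-- (verbatim) `P_k(φ) = L⁻⁴ Re⟨φ, Δ_d(k)ᴴ Δ_d(k) φ⟩`. -/
def pairWeight (k : TorusSite 2 L) (φ : Fock (Orb (FermionTorus 2 L))) : ℝ :=
  (expect ((pairMode L k)ᴴ * pairMode L k) φ).re / (L : ℝ) ^ 4

/-- (verbatim) window membership. -/
def inWindow (K : ℕ) (k : TorusSite 2 L) : Prop := ∀ i : Fin 2, min (k i).val (L - (k i).val) ≤ K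

instance (K : ℕ) (k : TorusSite 2 L) : Decidable (inWindow L K k) := by
  unfold inWindow; infer_instance

theorem pairWeight_nonneg (k : TorusSite 2 L) (φ : Fock (Orb (FermionTorus 2 L))) :
    0 ≤ pairWeight L k φ := by
  unfold pairWeight
  refine div_nonneg ?_ (by positivity)
  rw [expect, ← star_mulVec_dotProduct_mulVec]
  exact (Complex.nonneg_iff.1 (dotProduct_star_self_nonneg _)).1

omit [NeZero L] in
theorem inWindow_zero (K : ℕ) : inWindow L K 0 := by
  intro i
  simp

end Objects

/-- (verbatim) `S` at `(U, δ)` with a uniform floor `a`. -/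
def SummitAt (U δ a : ℝ) : Prop :=
  ∃ L₁ : ℕ, ∀ (L : ℕ) [NeZero L], L₁ ≤ L → Even L →
    ∀ ψ : Fock (Orb (FermionTorus 2 L)), star ψ ⬝ᵥ ψ = 1 →
      IsGroundStateInSector (hubbardTorus 2 L 1 U) (2 * ⌊(1 - δ) * (L : ℝ) ^ 2 / 2⌋₊) 0 ψ →
        a ≤ pairWeight L 0 ψ

/-- (verbatim) stmt-1510 at `(U, δ)`. -/
def CondensationAt (U δ : ℝ) : Prop :=
  ∃ K : ℕ, ∃ θ : ℝ, 0 < θ ∧ ∃ Γ : ℝ, 0 < Γ ∧ ∃ L₀ : ℕ, ∀ (L : ℕ) [NeZero L], L₀ ≤ L → Even L →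
    ∀ φ : Fock (Orb (FermionTorus 2 L)),
      φ ∈ szSector (2 * ⌊(1 - δ) * (L : ℝ) ^ 2 / 2⌋₊) 0 → star φ ⬝ᵥ φ = 1 →
      (expect (hubbardTorus 2 L 1 U) φ).re ≤
          (hubbardTorus 2 L 1 U).minEnergyOn (szSector (2 * ⌊(1 - δ) * (L : ℝ) ^ 2 / 2⌋₊) 0) + Γ →
        θ ≤ ∑ k ∈ Finset.univ.filter (fun k : TorusSite 2 L => inWindow L K k), pairWeight L k φ

/-- (verbatim body) the card's `MarginalRigidity` AT the point `(U, δ)`;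
`MarginalRigidity = ∀ U, 0 < U → ∀ δ ∈ Ioo 0 (1/2), MarginalRigidityAt U δ`. -/
def MarginalRigidityAt (U δ : ℝ) : Prop :=
  ∀ a : ℝ, 0 < a → SummitAt U δ a →
    ∀ (K : ℕ) (θ : ℝ), 0 < θ → ∃ κ : ℝ, 0 < κ ∧ ∃ a' : ℝ, 0 < a' ∧ ∃ L₀ : ℕ,
      ∀ (L : ℕ) [NeZero L], L₀ ≤ L → Even L →
        ∀ φ : Fock (Orb (FermionTorus 2 L)),
          φ ∈ szSector (2 * ⌊(1 - δ) * (L : ℝ) ^ 2 / 2⌋₊) 0 → star φ ⬝ᵥ φ = 1 →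
          (expect (hubbardTorus 2 L 1 U) φ).re ≤
              (hubbardTorus 2 L 1 U).minEnergyOn (szSector (2 * ⌊(1 - δ) * (L : ℝ) ^ 2 / 2⌋₊) 0) + κ →
          θ ≤ (∑ k ∈ Finset.univ.filter (fun k : TorusSite 2 L => inWindow L K k), pairWeight L k φ) →
            a' ≤ pairWeight L 0 φ

/-- The crux at the point: body of `DeformationLadder.LowEnergyRigidity` at `(U, δ)` in the card's
`pairWeight` vocabulary (`expect H φ := star φ ⬝ᵥ H *ᵥ φ` is definitional). -/
def LowEnergyRigidityAt (U δ : ℝ) : Prop :=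
  ∃ κ : ℝ, 0 < κ ∧ ∃ a : ℝ, 0 < a ∧ ∃ L₀ : ℕ, ∀ (L : ℕ) [NeZero L], L₀ ≤ L → Even L →
    ∀ φ : Fock (Orb (FermionTorus 2 L)),
      φ ∈ szSector (2 * ⌊(1 - δ) * (L : ℝ) ^ 2 / 2⌋₊) 0 → star φ ⬝ᵥ φ = 1 →
      (expect (hubbardTorus 2 L 1 U) φ).re ≤
          (hubbardTorus 2 L 1 U).minEnergyOn (szSector (2 * ⌊(1 - δ) * (L : ℝ) ^ 2 / 2⌋₊) 0) + κ →
        a ≤ pairWeight L 0 φ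

/-- **Upper slice of the sandwich**: the crux at `(U, δ)` implies `MarginalRigidity` there, for free
(ignore the window hypothesis). -/
theorem marginalRigidityAt_of_lowEnergyRigidityAt {U δ : ℝ} (h : LowEnergyRigidityAt U δ) :
    MarginalRigidityAt U δ := by
  intro _a _ha _hS _K _θ _hθ
  obtain ⟨κ, hκ, a, ha, L₀, h⟩ := h
  exact ⟨κ, hκ, a, ha, L₀, fun L _ hL hE φ hφ h1 hEn _ => h L hL hE φ hφ h1 hEn⟩

/-- **Lower slice of the sandwich** (the card's `CruxFromSummitSide`, at the point): `MR_at` is at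
least the implication "`S` ∧ window condensation ⇒ crux" at `(U, δ)`. -/
theorem lowEnergyRigidityAt_of_marginalRigidityAt {U δ : ℝ} (hMR : MarginalRigidityAt U δ)
    (hS : ∃ a : ℝ, 0 < a ∧ SummitAt U δ a) (hC : CondensationAt U δ) :
    LowEnergyRigidityAt U δ := by
  obtain ⟨a, ha, hS⟩ := hS
  obtain ⟨K, θ, hθ, Γ, hΓ, L₁, hC⟩ := hC
  obtain ⟨κ, hκ, a', ha', L₂, hM⟩ := hMR a ha hS K θ hθ
  refine ⟨min κ Γ, lt_min hκ hΓ, a', ha', max L₁ L₂, fun L _ hL hE φ hφ h1 hEn => ?_⟩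
  have hL₁ : L₁ ≤ L := le_trans (le_max_left _ _) hL
  have hL₂ : L₂ ≤ L := le_trans (le_max_right _ _) hL
  refine hM L hL₂ hE φ hφ h1 (hEn.trans (by linarith [min_le_left κ Γ])) ?_
  exact hC L hL₁ hE φ hφ h1 (hEn.trans (by linarith [min_le_right κ Γ]))

/-- The first hypothesis of the lower slice is a consequence of the crux at the point. -/
theorem summitAt_of_lowEnergyRigidityAt {U δ : ℝ} (h : LowEnergyRigidityAt U δ) :
    ∃ a : ℝ, 0 < a ∧ SummitAt U δ a := by
  obtain ⟨κ, hκ, a, ha, L₀, h⟩ := h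
  refine ⟨a, ha, L₀, fun L _ hL hE ψ h1 hGS => ?_⟩
  obtain ⟨hmem, -, heig⟩ := hGS
  refine h L hL hE ψ hmem h1 ?_
  have : expect (hubbardTorus 2 L 1 U) ψ =
      (((hubbardTorus 2 L 1 U).minEnergyOn (szSector (2 * ⌊(1 - δ) * (L : ℝ) ^ 2 / 2⌋₊) 0) : ℝ) : ℂ) := by
    rw [expect, heig, dotProduct_smul, h1, smul_eq_mul, mul_one]
  rw [this, Complex.ofReal_re]
  linarith

/-- The second hypothesis of the lower slice is a consequence of the crux at the point
(`K := 0`, `θ := a`, `Γ := κ`; the window contains `k = 0` and pair weights are nonnegative). -/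
theorem condensationAt_of_lowEnergyRigidityAt {U δ : ℝ} (h : LowEnergyRigidityAt U δ) :
    CondensationAt U δ := by
  obtain ⟨κ, hκ, a, ha, L₀, h⟩ := h
  refine ⟨0, a, ha, κ, hκ, L₀, fun L _ hL hE φ hφ h1 hEn => ?_⟩
  have h0 : a ≤ pairWeight L 0 φ := h L hL hE φ hφ h1 hEn
  refine h0.trans ?_
  refine Finset.single_le_sum (f := fun k => pairWeight L k φ) (fun k _ => pairWeight_nonneg L k φ) ?_
  simp only [Finset.mem_filter, Finset.mem_univ, true_and]
  exact inWindow_zero L 0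

/-- **Net**: at each point, `MR_at` holds iff the crux holds there OR one of (`S`, window
condensation) fails there — i.e. given the summit-side inputs it IS the crux. -/
theorem marginalRigidityAt_iff_of_inputs {U δ : ℝ} (hS : ∃ a : ℝ, 0 < a ∧ SummitAt U δ a)
    (hC : CondensationAt U δ) : MarginalRigidityAt U δ ↔ LowEnergyRigidityAt U δ :=
  ⟨fun h => lowEnergyRigidityAt_of_marginalRigidityAt h hS hC,
    marginalRigidityAt_of_lowEnergyRigidityAt⟩

end CruxTriage.MarginalRigidity
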